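import Mathlib
import HarnessLib
import Summits.HodgeConjecture.HodgeConjecture.Theses.KleimanBFSeeds
import Summits.HodgeConjecture.HodgeConjecture.Theses.DoublyPolarisedTransport
import Summits.HodgeConjecture.HodgeConjecture.Theorems.Ring2AbelianAllAndreTwistedSquareEvenInhabitants
import Summits.HodgeConjecture.HodgeConjecture.Theorems.Ring2AbelianAllWeilSimilarAnchors
import Summits.HodgeConjecture.HodgeConjecture.Theorems.Ring2AbelianAllWeilSignCells
import Literature.AlgebraicGeometry.VanGeemen1994.HyperbolicOfSplitDiscriminant
import Literature.AlgebraicGeometry.HodgeTheory.WeilClassesBFSheafSeedAt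
import Literature.AlgebraicGeometry.HodgeTheory.ISemiregularOfSchemeIso

/-!
# Reductions of the crux `KleimanSemiregularAnchor` (K2, stmt-HodgeConjecture-25931, route `KleimanBFSeeds`)

HONEST FRAMING: HELPER lemmas (`--supports stmt-HodgeConjecture-25931`); NOTHING here constructs an
`I`-semiregular sheaf, and nothing proves K2, its registered stub `stub_good : GoodAnchorInClass`
(skeleton `Cruxes/KleimanSemiregularAnchor/Lines/chosen_anchor.lean`), rung H2, HC_AV, HC_CM or HC. What is
proved is bookkeeping that SHRINKS what a proof of K2 has to produce:

* §1 ONE MODEL SUFFICES for the pointwise predicates of `WeilClassesBFSheafSeedAt.lean`: the every-model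
  `HasBFSheafSeedAt C n P h w` / `HasWeilClassDesignAt C n P h w` are equivalent to their clauses ON `P.X` ITSELF
  (`hasBFSheafSeedAt_iff_exists_on`, `hasWeilClassDesignAt_iff_exists_on`): push the one object forward along each
  model `e : P.X ≅ X₀` — finite locally free (`IsFiniteLocallyFree.pushforward_of_iso`), `I`-semiregular there
  (`IsISemiregular.of_schemeIso`, the Literature transport of Buchweitz–Flenner semiregularity along scheme
  isomorphisms), `e^* ch_p(e_* ℰ₀) = ch_p(ℰ₀)` (`ChernCharacterBetti.ch_pushforward_of_iso`). Hence the K2 upgrade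
  `HasWeilClassDesignAt → HasBFSheafSeedAt` at an anchor is the implication between the two ONE-MODEL clauses
  (`upgrade_iff_on_self`): ONE `I ∋ n`-semiregular finite locally free `ℰ₀` on `P.X` with `chₙ(ℰ₀) = q·hⁿ + N·w`,
  `N ≠ 0`, `ch_p(ℰ₀) = c_p·hᵖ` (`p ∈ I ∖ n`).
* §2 THE ∀-ANCHOR FORM IMPLIES THE CRUX: the route's aside item `KleimanSemiregularMember`
  (stmt-HodgeConjecture-25871: the upgrade at EVERY doubly-polarised anchor, model by model) gives
  `KleimanSemiregularAnchor`, the anchor being supplied by X2 `DoublyPolarisedSimilarAnchors` (stmt-HodgeConjecture-23603,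
  PROVED p602146 by `Theses.DoublyPolarisedTransport.doublyPolarisedSimilarAnchors_holds`; taken here as a binder BY NAME
  so that this file stays out of that theorem module's import cone)
  (`kleimanSemiregularAnchor_of_kleimanSemiregularMember`).
* §3 THE CRUX REDUCES TO THE TWISTED CM CUBES: X2's anchor for a non-hyperbolic member of discriminant class
  `[-m]` IS the twisted cube `(E₀³ × E₀³, φ × (−φ))`, `E₀ = ℂ/(ℤ + ℤ√-d)`, with a weight-`m` Segre class; so it
  suffices to prove the upgrade at the doubly-polarised anchors carried by twisted squares `T × T`, `T = E₀³` a cube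
  of a CM elliptic curve with `√-d`, `φ ≫ φ = -d` on `T` (`kleimanSemiregularAnchor_of_upgrade_on_twistedCubes`) —
  a maximal-Picard-number CM sixfold, the only anchor family a prover of `stub_good` needs to touch.

References: [BuchweitzFlenner2003] §5 (I-semiregular), Thm. 5.1; [Fulton1998] §15.1 (ii), Ex. 15.3.2;
[vanGeemen1994HodgeAV] Lemma 5.2 (3)–(4), 5.3–5.4; [Deligne1982HodgeCycles] proof of Thm. 4.8.
-/

-- every declaration of this problem lives in `Summit.HodgeConjecture.HodgeConjecture.…` (summit = sub-problem)
set_option linter.dupNamespace false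

noncomputable section

open CategoryTheory AlgebraicGeometry
open AlgebraicGeometry.Scheme.Modules

namespace Summit.HodgeConjecture.HodgeConjecture.Theorems

open Literature.AlgebraicGeometry Literature.AlgebraicGeometry.Motives Literature.AlgebraicGeometry.Modules
open Literature.AlgebraicGeometry.HodgeTheory
open Literature.AlgebraicGeometry.VanGeemen1994
open Literature.AlgebraicTopology.SingularHomology
open Summit.HodgeConjecture.HodgeConjecture.Ring2.AbelianAll

/-! ### §1 One model suffices for `HasBFSheafSeedAt` / `HasWeilClassDesignAt` -/

section OneModel

variable {C : ChernCharacterBetti} {n : ℕ} {P : AbelianVariety ℂ} {h : complexBetti P.X 2}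
  {w : complexBetti P.X (2 * n)}

/-- **One object on `P.X` gives the every-model Buchweitz–Flenner sheaf seed**: an `I ∋ n`-semiregular finite
locally free `ℰ₀` on `P.X` with `chₙ(ℰ₀) = q·hⁿ + N·w` (`N ≠ 0`) and `ch_p(ℰ₀) = c_p·hᵖ` (`p ∈ I ∖ n`) yields
`HasBFSheafSeedAt C n P h w`: along each model `e : P.X ≅ X₀` take `e_* ℰ₀` (finite locally free, `I`-semiregular by
`IsISemiregular.of_schemeIso`, `e^* ch_p(e_*ℰ₀) = e^*(e⁻¹)^* ch_p(ℰ₀) = ch_p(ℰ₀)`).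
[cite: BuchweitzFlenner2003, §5 (I-semiregular)] [cite: Fulton1998, §15.1 (ii)] -/
theorem hasBFSheafSeedAt_of_exists_on
    (hS : ∃ (I : Finset ℕ) (E₀ : P.X.left.Modules) (hE₀ : IsFiniteLocallyFree E₀) (q N : ℚ) (c : ℕ → ℚ),
      n ∈ I ∧ N ≠ 0 ∧ IsISemiregular hE₀ {q' | q' + 1 ∈ I} ∧
      C.ch P.X E₀ n = ((q : ℚ) : ℂ) • cupPowTwo h n + ((N : ℚ) : ℂ) • w ∧
      ∀ p' ∈ I, p' ≠ n → C.ch P.X E₀ p' = ((c p' : ℚ) : ℂ) • cupPowTwo h p') :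
    HasBFSheafSeedAt C n P h w := by
  obtain ⟨I, E₀, hE₀, q, N, c, hnI, hN, hsr, hchn, hchp⟩ := hS
  intro X₀ e
  refine ⟨I, (pushforward e.hom.left).obj E₀, hE₀.pushforward_of_iso (leftIso' e), q, N, c, hnI, hN,
    IsISemiregular.of_schemeIso e hE₀ hsr, ?_, fun p' hp' hpn => ?_⟩
  · rw [ChernCharacterBetti.ch_pushforward_of_iso C e hE₀,
      BuchweitzFlenner2003_variationalHodge_ISemiregular_model.map_hom_map_inv, hchn]
  · rw [ChernCharacterBetti.ch_pushforward_of_iso C e hE₀,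
      BuchweitzFlenner2003_variationalHodge_ISemiregular_model.map_hom_map_inv, hchp p' hp' hpn]

/-- The every-model sheaf seed gives the one-model clause on `P.X` (model `Iso.refl`).
[cite: BuchweitzFlenner2003, §5 (I-semiregular)] -/
theorem exists_on_of_hasBFSheafSeedAt (hS : HasBFSheafSeedAt C n P h w) :
    ∃ (I : Finset ℕ) (E₀ : P.X.left.Modules) (hE₀ : IsFiniteLocallyFree E₀) (q N : ℚ) (c : ℕ → ℚ),
      n ∈ I ∧ N ≠ 0 ∧ IsISemiregular hE₀ {q' | q' + 1 ∈ I} ∧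
      C.ch P.X E₀ n = ((q : ℚ) : ℂ) • cupPowTwo h n + ((N : ℚ) : ℂ) • w ∧
      ∀ p' ∈ I, p' ≠ n → C.ch P.X E₀ p' = ((c p' : ℚ) : ℂ) • cupPowTwo h p' := by
  obtain ⟨I, E₀, hE₀, q, N, c, hnI, hN, hsr, hchn, hchp⟩ := hS P.X (Iso.refl _)
  refine ⟨I, E₀, hE₀, q, N, c, hnI, hN, hsr, ?_, fun p' hp' hpn => ?_⟩
  · have h' := hchn
    simp only [Iso.refl_hom, complexBetti.map_id] at h'
    exact h'
  · have h' := hchp p' hp' hpn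
    simp only [Iso.refl_hom, complexBetti.map_id] at h'
    exact h'

/-- **`HasBFSheafSeedAt` is its one-model clause** (the `∀ X₀ ≅ P.X` quantifier is free).
[cite: BuchweitzFlenner2003, §5 (I-semiregular)] [cite: Fulton1998, §15.1 (ii)] -/
theorem hasBFSheafSeedAt_iff_exists_on :
    HasBFSheafSeedAt C n P h w ↔
      ∃ (I : Finset ℕ) (E₀ : P.X.left.Modules) (hE₀ : IsFiniteLocallyFree E₀) (q N : ℚ) (c : ℕ → ℚ),
        n ∈ I ∧ N ≠ 0 ∧ IsISemiregular hE₀ {q' | q' + 1 ∈ I} ∧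
        C.ch P.X E₀ n = ((q : ℚ) : ℂ) • cupPowTwo h n + ((N : ℚ) : ℂ) • w ∧
        ∀ p' ∈ I, p' ≠ n → C.ch P.X E₀ p' = ((c p' : ℚ) : ℂ) • cupPowTwo h p' :=
  ⟨exists_on_of_hasBFSheafSeedAt, hasBFSheafSeedAt_of_exists_on⟩

/-- **One object on `P.X` gives the every-model class design**: a finite locally free `ℰ₀` on `P.X` with
`chₙ(ℰ₀) = q·hⁿ + N·w` (`N ≠ 0`) and `ch_p(ℰ₀) = c_p·hᵖ` (`0 < p < n`) yields `HasWeilClassDesignAt C n P h w`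
(push forward along each model; `e^* ch_p(e_*ℰ₀) = ch_p(ℰ₀)`). [cite: Fulton1998, §15.1 (ii) and Example 15.3.2] -/
theorem hasWeilClassDesignAt_of_exists_on
    (hD : ∃ (E₀ : P.X.left.Modules) (_ : IsFiniteLocallyFree E₀) (q N : ℚ) (c : ℕ → ℚ), N ≠ 0 ∧
      C.ch P.X E₀ n = ((q : ℚ) : ℂ) • cupPowTwo h n + ((N : ℚ) : ℂ) • w ∧
      ∀ p : ℕ, 0 < p → p < n → C.ch P.X E₀ p = ((c p : ℚ) : ℂ) • cupPowTwo h p) :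
    HasWeilClassDesignAt C n P h w := by
  obtain ⟨E₀, hE₀, q, N, c, hN, hchn, hchp⟩ := hD
  intro X₀ e
  refine ⟨(pushforward e.hom.left).obj E₀, hE₀.pushforward_of_iso (leftIso' e), q, N, c, hN, ?_,
    fun p hp hpn => ?_⟩
  · rw [ChernCharacterBetti.ch_pushforward_of_iso C e hE₀,
      BuchweitzFlenner2003_variationalHodge_ISemiregular_model.map_hom_map_inv, hchn]
  · rw [ChernCharacterBetti.ch_pushforward_of_iso C e hE₀,
      BuchweitzFlenner2003_variationalHodge_ISemiregular_model.map_hom_map_inv, hchp p hp hpn]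

/-- The every-model class design gives the one-model clause on `P.X` (model `Iso.refl`).
[cite: Fulton1998, Example 15.3.2] -/
theorem exists_on_of_hasWeilClassDesignAt (hD : HasWeilClassDesignAt C n P h w) :
    ∃ (E₀ : P.X.left.Modules) (_ : IsFiniteLocallyFree E₀) (q N : ℚ) (c : ℕ → ℚ), N ≠ 0 ∧
      C.ch P.X E₀ n = ((q : ℚ) : ℂ) • cupPowTwo h n + ((N : ℚ) : ℂ) • w ∧
      ∀ p : ℕ, 0 < p → p < n → C.ch P.X E₀ p = ((c p : ℚ) : ℂ) • cupPowTwo h p := by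
  obtain ⟨E₀, hE₀, q, N, c, hN, hchn, hchp⟩ := hD P.X (Iso.refl _)
  refine ⟨E₀, hE₀, q, N, c, hN, ?_, fun p hp hpn => ?_⟩
  · have h' := hchn
    simp only [Iso.refl_hom, complexBetti.map_id] at h'
    exact h'
  · have h' := hchp p hp hpn
    simp only [Iso.refl_hom, complexBetti.map_id] at h'
    exact h'

/-- **`HasWeilClassDesignAt` is its one-model clause.** [cite: Fulton1998, §15.1 (ii) and Example 15.3.2] -/
theorem hasWeilClassDesignAt_iff_exists_on :
    HasWeilClassDesignAt C n P h w ↔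
      ∃ (E₀ : P.X.left.Modules) (_ : IsFiniteLocallyFree E₀) (q N : ℚ) (c : ℕ → ℚ), N ≠ 0 ∧
        C.ch P.X E₀ n = ((q : ℚ) : ℂ) • cupPowTwo h n + ((N : ℚ) : ℂ) • w ∧
        ∀ p : ℕ, 0 < p → p < n → C.ch P.X E₀ p = ((c p : ℚ) : ℂ) • cupPowTwo h p :=
  ⟨exists_on_of_hasWeilClassDesignAt, hasWeilClassDesignAt_of_exists_on⟩

/-- **The K2 upgrade at an anchor is an implication between ONE-MODEL clauses**: `HasWeilClassDesignAt C n P h w →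
HasBFSheafSeedAt C n P h w` holds iff ONE finite locally free design `ℰ₀` on `P.X` (`chₙ = q·hⁿ + N·w`, lower `ch_p`
on the `h`-line) yields ONE `I ∋ n`-semiregular finite locally free `ℰ₀'` on `P.X` of the seed shape.
[cite: BuchweitzFlenner2003, §5 (I-semiregular)] [cite: Fulton1998, Example 15.3.2] -/
theorem upgrade_iff_on_self :
    (HasWeilClassDesignAt C n P h w → HasBFSheafSeedAt C n P h w) ↔
      ((∃ (E₀ : P.X.left.Modules) (_ : IsFiniteLocallyFree E₀) (q N : ℚ) (c : ℕ → ℚ), N ≠ 0 ∧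
          C.ch P.X E₀ n = ((q : ℚ) : ℂ) • cupPowTwo h n + ((N : ℚ) : ℂ) • w ∧
          ∀ p : ℕ, 0 < p → p < n → C.ch P.X E₀ p = ((c p : ℚ) : ℂ) • cupPowTwo h p) →
        ∃ (I : Finset ℕ) (E₀ : P.X.left.Modules) (hE₀ : IsFiniteLocallyFree E₀) (q N : ℚ) (c : ℕ → ℚ),
          n ∈ I ∧ N ≠ 0 ∧ IsISemiregular hE₀ {q' | q' + 1 ∈ I} ∧
          C.ch P.X E₀ n = ((q : ℚ) : ℂ) • cupPowTwo h n + ((N : ℚ) : ℂ) • w ∧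
          ∀ p' ∈ I, p' ≠ n → C.ch P.X E₀ p' = ((c p' : ℚ) : ℂ) • cupPowTwo h p') := by
  rw [hasWeilClassDesignAt_iff_exists_on, hasBFSheafSeedAt_iff_exists_on]

end OneModel

/-! ### §2 The ∀-anchor form (`KleimanSemiregularMember`, item 25871) implies the crux -/

/-- **`DoublyPolarisedSimilarAnchors → KleimanSemiregularMember → KleimanSemiregularAnchor`**: for a non-hyperbolic
member `(A, φ)` with a non-zero Hodge Weil class, X2 `DoublyPolarisedSimilarAnchors` (stmt-HodgeConjecture-23603, PROVED:
`Theses.DoublyPolarisedTransport.doublyPolarisedSimilarAnchors_holds`, p602146) supplies a doubly-polarised anchor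
`(P, ψ₀, h, h', w)` Weil-similar to it; the ∀-anchor upgrade `KleimanSemiregularMember` (stmt-HodgeConjecture-25871),
applied model by model to the design handed over by `HasWeilClassDesignAt` (its `ch₁`, `ch₂` coefficients read off at
`p = 1, 2`), is the seed. [cite: vanGeemen1994HodgeAV, Lemma 5.2 (3)–(4) and 5.3–5.4] [cite: BuchweitzFlenner2003, §5 (I-semiregular)] -/
theorem kleimanSemiregularAnchor_of_kleimanSemiregularMember
    (hX2 : Summit.HodgeConjecture.HodgeConjecture.Theses.DoublyPolarisedTransport.DoublyPolarisedSimilarAnchors)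
    (hmem : Summit.HodgeConjecture.HodgeConjecture.Theses.KleimanBFSeeds.KleimanSemiregularMember) :
    Summit.HodgeConjecture.HodgeConjecture.Theses.KleimanBFSeeds.KleimanSemiregularAnchor := by
  intro C d hd A φ hA hφ hnh hwA
  obtain ⟨eA, aA, P, ψ₀, e, e', a, a', w, haA, haA0, hP, hψ, ha, ha0, ha', ha'0, hwW, hwrat, hw0, hwH,
    hhyp, hnhyp, hsim⟩ := hX2 d hd A φ hA hφ hnh hwA
  refine ⟨eA, aA, P, ψ₀, e, e', a, a', w, haA, haA0, hP, hψ, ha, ha0, ha', ha'0, hwW, hwrat, hw0, hwH,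
    hhyp, hnhyp, fun hdes X₀ eX => ?_, hsim⟩
  obtain ⟨E₀, hE₀, q, N, c, hN, hch3, hchp⟩ := hdes X₀ eX
  exact hmem C d hd P ψ₀ e e' a a' w hP hψ ha ha0 ha' ha'0 hwW hw0 hhyp hnhyp X₀ eX
    ⟨E₀, hE₀, q, N, c 1, c 2, hN, hchp 1 one_pos (by norm_num), hchp 2 two_pos (by norm_num), hch3⟩

/-! ### §3 The crux reduces to the twisted CM cubes `E₀³ × E₀³` -/

/-- **K2 reduces to the twisted CM cubes.** Suppose that for every `d ≥ 1`, every CM elliptic curve `(E₀, ψ₀)`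
(`dim E₀ = 1`, `ψ₀ ≫ ψ₀ = -d`), every `φ` with `φ ≫ φ = -d` on the cube `T = E₀³` (`E₀.powSucc 2`), and every
doubly-polarised `(3, d)` anchor `(e, e', a, a', w)` carried by the twisted square `(T × T, Φ = φ × (−φ))` (anchor
conjuncts of the crux verbatim: `a`, `a'` rational `≠ 0`; `w` a non-zero rational `(3,3)` Weil class; `Φ` hyperbolic
at `h(e', a')`, not hyperbolic at `h(e, a)`, `h(e, a) = d·e^*a + Φ^*e^*a`), every Chern character `C` upgrades class
designs to sheaf seeds there (`HasWeilClassDesignAt C 3 (T × T) h(e,a) w → HasBFSheafSeedAt C 3 (T × T) h(e,a) w`).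
Then `KleimanSemiregularAnchor`. Proof = X2's (`doublyPolarisedSimilarAnchors_holds`): the member's discriminant
class is `[-m]`, `m ≥ 1` (non-split); the twisted cube of `E₀ = ℂ/(ℤ + ℤ√-d)` carries a weight-`m` Segre class of
the same discriminant class (Weil-similar by Landherr, not hyperbolic) and a weight-`1` (split, hyperbolic) one.
[cite: vanGeemen1994HodgeAV, 4.14, Lemma 5.2 (3)–(4), 5.3–5.4 (5.4.1)] [cite: Landherr1936HermitianForms]
[cite: Deligne1982HodgeCycles, proof of Thm. 4.8 and Remark 4.10] [cite: Markman2025SurveySecant, §11.5 Steps 1–2] -/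
theorem kleimanSemiregularAnchor_of_upgrade_on_twistedCubes
    (hup : ∀ (C : ChernCharacterBetti) (d : ℕ), 0 < d →
      ∀ (E₀ : AbelianVariety ℂ) (ψ₀ : E₀ ⟶ E₀) (φ : E₀.powSucc 2 ⟶ E₀.powSucc 2)
        (Φ : (E₀.powSucc 2).prod (E₀.powSucc 2) ⟶ (E₀.powSucc 2).prod (E₀.powSucc 2)),
        E₀.dim = 1 → ψ₀ ≫ ψ₀ = -(d • 𝟙 E₀) → φ ≫ φ = -(d • 𝟙 (E₀.powSucc 2)) →
        Φ = AbelianVariety.prodLift (AbelianVariety.fst (E₀.powSucc 2) (E₀.powSucc 2) ≫ φ)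
          (AbelianVariety.snd (E₀.powSucc 2) (E₀.powSucc 2) ≫ (-φ)) →
        ∀ (e e' : ProjectiveEmbedding ((E₀.powSucc 2).prod (E₀.powSucc 2)).X)
          (a : complexBetti (projectiveSpace e.n ℂ) 2) (a' : complexBetti (projectiveSpace e'.n ℂ) 2)
          (w : complexBetti ((E₀.powSucc 2).prod (E₀.powSucc 2)).X (2 * 3)),
          IsRationalClass a → a ≠ 0 → IsRationalClass a' → a' ≠ 0 →
          w ∈ weilClassesOf ((E₀.powSucc 2).prod (E₀.powSucc 2)) Φ 3 d → IsRationalClass w → w ≠ 0 →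
          IsOfHodgeType (2 * 3) ((E₀.powSucc 2).prod (E₀.powSucc 2)).X (2 * 3) 3 3 w →
          IsHyperbolicWeilType ((E₀.powSucc 2).prod (E₀.powSucc 2)) Φ 3
            ((d : ℂ) • complexBetti.map e'.ι 2 a' + complexBetti.map Φ.hom.hom.hom 2 (complexBetti.map e'.ι 2 a')) →
          ¬ IsHyperbolicWeilType ((E₀.powSucc 2).prod (E₀.powSucc 2)) Φ 3
            ((d : ℂ) • complexBetti.map e.ι 2 a + complexBetti.map Φ.hom.hom.hom 2 (complexBetti.map e.ι 2 a)) →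
          HasWeilClassDesignAt C 3 ((E₀.powSucc 2).prod (E₀.powSucc 2))
            ((d : ℂ) • complexBetti.map e.ι 2 a + complexBetti.map Φ.hom.hom.hom 2 (complexBetti.map e.ι 2 a)) w →
          HasBFSheafSeedAt C 3 ((E₀.powSucc 2).prod (E₀.powSucc 2))
            ((d : ℂ) • complexBetti.map e.ι 2 a + complexBetti.map Φ.hom.hom.hom 2 (complexBetti.map e.ι 2 a)) w) :
    Summit.HodgeConjecture.HodgeConjecture.Theses.KleimanBFSeeds.KleimanSemiregularAnchor := by
  intro C d hd A φ hA hφ hns hwA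
  obtain ⟨wA, hwA, hwA0, hwAH⟩ := hwA
  have n3 : (0 : ℕ) < 3 := by norm_num
  -- `(A, φ)` is of Weil type `(3, d)` (Deligne–Milne 4.4 ⇒)
  have hW' : IsWeilType A φ 3 d := isWeilType_of_weilClass_ne_zero n3 hd hA hφ hwA hwA0 hwAH
  -- a projective embedding of `A` with a non-zero rational ambient class
  obtain ⟨eA, aA, haA, haA0, -⟩ := exists_weightedSegreEmbedding_self_prod A
  -- its discriminant class, of sign `(-1)³`
  obtain ⟨δ, hδA, hsign⟩ := exists_hasWeilDiscriminantNondeg_weilSign hW' eA haA haA0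
  -- … which is not the split class, `A` being non-split
  have hne : δ ≠ QuotientGroup.mk ((-1 : ℚˣ) ^ 3) := by
    rintro rfl
    obtain ⟨-, e, a, ha, ha0, hh⟩ :=
      Literature.AlgebraicGeometry.VanGeemen1994.IsWeilType.isSplitWeilType_of_hasWeilDiscriminantNondeg_split
        hW' eA haA haA0 hδA
    exact hns e a ha ha0 hh
  -- `δ = [-m]` for a positive integer `m`
  obtain ⟨q, rfl⟩ := QuotientGroup.mk_surjective δ
  have hq : (q : ℚ) < 0 := by
    rw [weilSign_mk] at hsign
    have h3 : ((-1 : ℤˣ) ^ 3) = -1 := Odd.neg_one_pow ⟨1, by norm_num⟩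
    exact (ratSign_eq_neg_one_iff q).1 (hsign.trans h3)
  obtain ⟨m, hm, hmq⟩ := exists_nat_mk_neg_eq (d := d) q hq
  -- the CM curve `E₀ = ℂ/(ℤ + ℤ√-d)` and `T = E₀³` with a `K`-structure `φT`
  obtain ⟨E₀, ψ₀, hE, hψ⟩ := Literature.NumberTheory.EllipticCurves.CMEndomorphism.exists_cmCurve_sqrt_neg d hd
  obtain ⟨φT, hφT⟩ := exists_sq_eq_neg_powSucc ψ₀ hψ 2
  have hT : (E₀.powSucc 2).dim = 2 + 1 := by rw [dim_powSucc', hE, mul_one]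
  -- `P = T × T`, `Φ = φ_T × (-φ_T)`: a Weil sixfold
  have hPdim : ((E₀.powSucc 2).prod (E₀.powSucc 2)).dim = 2 * 3 := dim_twistedSquare hT
  have hΦ := twistedSquare_comp_self hφT
  have hWP : IsWeilType ((E₀.powSucc 2).prod (E₀.powSucc 2))
      (AbelianVariety.prodLift (AbelianVariety.fst (E₀.powSucc 2) (E₀.powSucc 2) ≫ φT)
        (AbelianVariety.snd (E₀.powSucc 2) (E₀.powSucc 2) ≫ (-φT))) 3 d :=
    isWeilType_twistedSquare n3 hT hd hφT
  -- the weighted Segre embeddings of `T × T`: weight `m'` has class `[(-m')³]`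
  obtain ⟨eT, aT, haT, haT0, hfam⟩ :=
    exists_hasWeilDiscriminantNondeg_twistedSquare (m₀ := 2) (by norm_num) hT hd hφT
  -- weight `1`: the split class `[(-1)³]`, hence a hyperbolic `K`-symmetrised hyperplane class `h'`
  obtain ⟨e₁, a₁, w₁, ha₁, ha₁0, hw₁, -, hN₁⟩ := hfam 1 one_pos
  have hw₁' : w₁ = (-1 : ℚˣ) ^ 3 := by
    ext
    rw [hw₁]
    push_cast
    norm_num
  rw [hw₁'] at hN₁
  obtain ⟨-, e', a', ha', ha'0, hhyp⟩ :=
    Literature.AlgebraicGeometry.VanGeemen1994.IsWeilType.isSplitWeilType_of_hasWeilDiscriminantNondeg_split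
      hWP e₁ ha₁ ha₁0 hN₁
  -- weight `m`: class `[(-m)³] = [-m] = δ`
  obtain ⟨e, a, w, ha, ha0, hw, -, hN⟩ := hfam m hm
  have hwm : w = (-Units.mk0 (m : ℚ) (Nat.cast_ne_zero.2 hm.ne')) ^ (2 * 1 + 1) := by
    ext
    rw [hw]
    simp only [Units.val_pow_eq_pow_val, Units.val_neg, Units.val_mk0]
  have hwδ : (QuotientGroup.mk w : weilNormResidueGroup d) = QuotientGroup.mk q := by
    rw [hwm, weilNormResidueGroup_mk_pow_odd, hmq]
  rw [hwδ] at hN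
  -- `h` is not hyperbolic (class `δ ≠ [(-1)³]`, van Geemen (5.4.1) ⟸)
  have hnot := not_isHyperbolicWeilType_of_hasWeilDiscriminantNondeg_ne n3 hPdim hd hΦ e ha ha0 hN hne
  -- a non-zero rational `(3,3)` class of the Weil plane of `T × T`
  obtain ⟨w₀, hw₀, hw₀0, hw₀Q⟩ := exists_isRationalClass_ne_zero_mem_weilClassesOf n3 hPdim hd hΦ
  have hw₀H := hWP.isOfHodgeType_of_mem_weilClassesOf hw₀
  -- Landherr: same class `δ` ⟹ Weil-similar
  have hsim := isWeilSimilar_of_hasWeilDiscriminantNondeg hWP hW' e ha ha0 eA haA haA0 hN hδA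
  exact ⟨eA, aA, (E₀.powSucc 2).prod (E₀.powSucc 2), _, e, e', a, a', w₀, haA, haA0, hPdim, hΦ, ha, ha0,
    ha', ha'0, hw₀, hw₀Q, hw₀0, hw₀H, hhyp, hnot,
    hup C d hd E₀ ψ₀ φT _ hE hψ hφT rfl e e' a a' w₀ ha ha0 ha' ha'0 hw₀ hw₀Q hw₀0 hw₀H hhyp hnot, hsim⟩

/-! ### §4 One good anchor PER DISCRIMINANT CLASS suffices (Landherr bookkeeping discharged)

The registered stub `stub_good : GoodAnchorInClass` asks, for every doubly-polarised anchor `P`, a good anchor `P'`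
WEIL-SIMILAR to `P` (rational frames, common matrices). By van Geemen 5.2 (3)–(4) / Landherr on the tree's carriers
(`isWeilSimilar_of_hasWeilDiscriminantNondeg`, `exists_hasWeilDiscriminantNondeg_weilSign`,
`not_isHyperbolicWeilType_of_hasWeilDiscriminantNondeg_ne`) the similitude class of a `(3, d)` member is its
DISCRIMINANT CLASS `δ ∈ ℚˣ/Nm(K_dˣ)` (sign `(-1)³`; non-hyperbolic members are exactly the classes `δ ≠ [(-1)³]`), so
K2 follows from: for every `C`, `d ≥ 1` and every class `δ` of sign `(-1)³` other than the split class, SOME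
`(3, d)` anchor `(P, ψ₀, e, e', a, a', w)` — `w` a non-zero rational `(3,3)` Weil class, `Φ` hyperbolic at `h(e', a')`,
`h(e, a)` carrying a non-degenerate discriminant witness OF CLASS `δ` — at which the upgrade
`HasWeilClassDesignAt → HasBFSheafSeedAt` holds. Non-hyperbolicity of `h(e, a)` and the Weil-similarity to the member
are then theorems, not obligations; by §3 / X2 the twisted CM cubes realise every such `δ` (weight-`m` Segre classes,
`δ = [-m]`), so the prover may (but need not) take `P = E₀³ × E₀³`. -/

/-- **K2 from ONE good anchor per discriminant class.** If for every Chern character `C`, every `d ≥ 1` and every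
norm-residue class `δ ∈ ℚˣ/Nm(ℚ(√-d)ˣ)` of sign `(-1)³` different from the split class `[(-1)³]` there is a
`(3, d)` anchor `(P, ψ₀, e, e', a, a', w)` (`dim P = 6`, `ψ₀² = -d`, `a`, `a'` rational `≠ 0`, `w` a non-zero rational
`(3,3)` Weil class, `Φ` hyperbolic at `h(e', a')`) whose `K`-symmetrised class `h(e, a) = d·e^*a + ψ₀^*e^*a` has a
non-degenerate discriminant witness of class `δ` (`HasWeilDiscriminantNondeg`) and at which class designs upgrade to
Buchweitz–Flenner sheaf seeds, then `KleimanSemiregularAnchor`. Proof: the member `(A, φ)` is of Weil type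
(`isWeilType_of_weilClass_ne_zero`), its class `δ` has sign `(-1)³` (`exists_hasWeilDiscriminantNondeg_weilSign`) and is
not split (else `A` would be hyperbolic somewhere, `isSplitWeilType_of_hasWeilDiscriminantNondeg_split`); the supplied
anchor is not hyperbolic at `h(e, a)` (`not_isHyperbolicWeilType_of_hasWeilDiscriminantNondeg_ne`) and is Weil-similar
to the member by Landherr (`isWeilSimilar_of_hasWeilDiscriminantNondeg`).
[cite: vanGeemen1994HodgeAV, 4.14, Lemma 5.2 (1)–(4), 5.3–5.4 (5.4.1)] [cite: Landherr1936HermitianForms]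
[cite: Deligne1982HodgeCycles, proof of Thm. 4.8] -/
theorem kleimanSemiregularAnchor_of_goodAnchor_in_each_discriminantClass
    (hgood : ∀ (C : ChernCharacterBetti) (d : ℕ) (δ : weilNormResidueGroup d), 0 < d →
      weilSign d δ = (-1) ^ 3 → δ ≠ QuotientGroup.mk ((-1 : ℚˣ) ^ 3) →
      ∃ (P : AbelianVariety ℂ) (ψ₀ : P ⟶ P) (e e' : ProjectiveEmbedding P.X)
        (a : complexBetti (projectiveSpace e.n ℂ) 2) (a' : complexBetti (projectiveSpace e'.n ℂ) 2)
        (w : complexBetti P.X (2 * 3)),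
        P.dim = 2 * 3 ∧ ψ₀ ≫ ψ₀ = -(d • 𝟙 P) ∧ IsRationalClass a ∧ a ≠ 0 ∧ IsRationalClass a' ∧ a' ≠ 0 ∧
        w ∈ weilClassesOf P ψ₀ 3 d ∧ IsRationalClass w ∧ w ≠ 0 ∧ IsOfHodgeType (2 * 3) P.X (2 * 3) 3 3 w ∧
        IsHyperbolicWeilType P ψ₀ 3
          ((d : ℂ) • complexBetti.map e'.ι 2 a' + complexBetti.map ψ₀.hom.hom.hom 2 (complexBetti.map e'.ι 2 a')) ∧
        HasWeilDiscriminantNondeg P ψ₀ 3 d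
          ((d : ℂ) • complexBetti.map e.ι 2 a + complexBetti.map ψ₀.hom.hom.hom 2 (complexBetti.map e.ι 2 a)) δ ∧
        (HasWeilClassDesignAt C 3 P
            ((d : ℂ) • complexBetti.map e.ι 2 a + complexBetti.map ψ₀.hom.hom.hom 2 (complexBetti.map e.ι 2 a)) w →
          HasBFSheafSeedAt C 3 P
            ((d : ℂ) • complexBetti.map e.ι 2 a + complexBetti.map ψ₀.hom.hom.hom 2 (complexBetti.map e.ι 2 a)) w)) :
    Summit.HodgeConjecture.HodgeConjecture.Theses.KleimanBFSeeds.KleimanSemiregularAnchor := by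
  intro C d hd A φ hA hφ hns hwA
  obtain ⟨wA, hwA, hwA0, hwAH⟩ := hwA
  have n3 : (0 : ℕ) < 3 := by norm_num
  -- `(A, φ)` is of Weil type `(3, d)`; an embedding; its discriminant class `δ` (sign `(-1)³`, not split)
  have hW' : IsWeilType A φ 3 d := isWeilType_of_weilClass_ne_zero n3 hd hA hφ hwA hwA0 hwAH
  obtain ⟨eA, aA, haA, haA0, -⟩ := exists_weightedSegreEmbedding_self_prod A
  obtain ⟨δ, hδA, hsign⟩ := exists_hasWeilDiscriminantNondeg_weilSign hW' eA haA haA0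
  have hne : δ ≠ QuotientGroup.mk ((-1 : ℚˣ) ^ 3) := by
    rintro rfl
    obtain ⟨-, e, a, ha, ha0, hh⟩ :=
      Literature.AlgebraicGeometry.VanGeemen1994.IsWeilType.isSplitWeilType_of_hasWeilDiscriminantNondeg_split
        hW' eA haA haA0 hδA
    exact hns e a ha ha0 hh
  -- the good anchor of class `δ`
  obtain ⟨P, ψ₀, e, e', a, a', w, hP, hψ, ha, ha0, ha', ha'0, hwW, hwrat, hw0, hwH, hhyp, hN, hup⟩ :=
    hgood C d δ hd hsign hne
  have hWP : IsWeilType P ψ₀ 3 d := isWeilType_of_weilClass_ne_zero n3 hd hP hψ hwW hw0 hwH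
  -- not hyperbolic at `h(e, a)` (class `δ ≠ [(-1)³]`), and Weil-similar to the member (Landherr)
  have hnot := not_isHyperbolicWeilType_of_hasWeilDiscriminantNondeg_ne n3 hP hd hψ e ha ha0 hN hne
  have hsim := isWeilSimilar_of_hasWeilDiscriminantNondeg hWP hW' e ha ha0 eA haA haA0 hN hδA
  exact ⟨eA, aA, P, ψ₀, e, e', a, a', w, haA, haA0, hP, hψ, ha, ha0, ha', ha'0, hwW, hwrat, hw0, hwH, hhyp,
    hnot, hup, hsim⟩

end Summit.HodgeConjecture.HodgeConjecture.Theorems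

end
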